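import Literature.NumberTheory.EllipticCurves.PAdicLFunctionTameDepletionCongruenceAtTwoSharedPrimesProofs
import HarnessLib

/-!
# Route `AlignedTransportAtTwo`, crux C1 `MainConjectureTransportAlignedAtTwo` (stmt-BirchSwinnertonDyer-22296), line `birth` —
# the BOTH-ADDITIVE twist sub-cell, part 1 (CUSPS): modular symbols of a newform at the cusps over a prime `ℓ` whose
# SQUARE divides the level: cusp classes over `ℓ` and the Hecke relation `T_q` at the cusps `u/ℓ``

HONEST FRAMING (cell `bsd-f1-sign2`, WIDTH-5 attach seat `bsd-line-att-p4` g9, under the lead `bsd-line-att-p1`). BSD is NOT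
proved; C1 is NOT closed. THEOREMS ONLY; nothing asserted; `--supports stmt-BirchSwinnertonDyer-22296 --as helper`. The lead's
`…TwistReachRung` (g8) proves the `(μ, λ)` line law at `2` on every square-free twist pair `W₂ ≅ W₁^{(d)}` at each prime of
which AT LEAST ONE curve is semistable; what is left of the twist part of C1 is the pairs with a prime `ℓ ∣ d` at which BOTH
curves are additive. There the tree's route (the tame congruence `L₂(f,α,χ) ≡ L₂(f,α,𝟙_m) (mod 2Λ)` from the `Γ₀(N)`-class
of the cusp `1/g`, `gcd(g, N/g) = 1`, `…TameIntegralityAtTwoSharedPrimesProofs`) does not apply: for `ℓ² ∣ N` the cusps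
`u/ℓ`, `u ∈ (ℤ/ℓ)ˣ`, are pairwise INEQUIVALENT. This file supplies the substitute.

THE MECHANISM (this file, `N` any level with `ℓ² ∣ N`, `f` a rational newform with `a_ℓ(f) = 0`):
* §1 `modularSymbol_div_mul_sub_mem_periodLattice` — **cusp classes over `ℓ` when `ℓ² ∣ N`**: for `gcd(k, pN) = 1`,
  `{∞, p/(kℓ)}_f − {∞, kp/ℓ}_f ∈ Λ_f` (explicit `Γ₀(N)`-matrix `(a, −p²(N/ℓ²)t; Nt, k(1 − (N/ℓ)tp))`, `ak − p(N/ℓ)t = 1`),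
  i.e. the class of a cusp of denominator `kℓ` is `[kp/ℓ]` (Cremona's criterion, Lemma 2.2.3, case `gcd(q₁, N) = gcd(q₂, N) = ℓ`
  with `ℓ ∣ N/ℓ`); §2 the same for the rational plus symbols, `[p/(kℓ)]⁺ = [kp/ℓ]⁺ + j/2`.
* §3 `exists_intCast_mul_ratPlusSymbol_div_eq` — **`T_q` at the cusps `u/ℓ`** (`q ∤ N` prime): `a_q[u/ℓ]⁺ = q[qu/ℓ]⁺ + [u'/ℓ]⁺ + j/2`
  with `qu' ≡ u (mod ℓ)` (the `q + 1` cusps `(u + jℓ)/(qℓ)`, `qu/ℓ` of the Hecke relation: the `q − 1 + 1` with `q ∤ u + jℓ`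
  lie in the class `[qu/ℓ]`, the one with `q ∣ u + jℓ` IS `((u+jℓ)/q)/ℓ`).
* companion `…AddTwistHalfSums` (§4): `U_ℓ`-vanishing (`a_ℓ = 0` gives `Σ_{b mod ℓ} [b/ℓ]⁺ = 0` exactly) and THE HALF-CHARACTER SUMS
  `Σ_{χ(b) = ε} [b/ℓ]⁺ = j/(2n₁)`, `n₁` ODD, from ONE good odd prime `q` with `a_q − q − 1` odd (`E[2]` irreducible); then
  `…AddTwistTame`: `‖Σ_{χ(b)=−1} μ_{f,α,ℓ}(· × {b})‖₂ ≤ 2` and `L₂(f,α,χ_ℓ) ≡ L₂(f,α,𝟙_ℓ) = −(1+T)^{c}·L₂(f,α) (mod 2Λ)` — the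
  analytic Kida step at `2` with ZERO local terms at a both-additive prime.

References: [CremonaAlgorithms1997] §2.2 Lemma 2.2.3, §2.8 (2.8.8); [Manin1972] Prop. 1.4, Thm. 1.6; [MazurTateTeitelbaum1986Invent]
§I.4 (4.2), §I.8, §I.10; [Matsuno2000] Lemma 3.2 (p. 87); [GreenbergVatsal2000] Prop. (3.7); [DarmonDiamondTaylor1995] Prop. 2.6(b).
-/

set_option autoImplicit false
set_option linter.dupNamespace false

noncomputable section

open scoped Classical MatrixGroups ModularForm

open CongruenceSubgroup Literature.NumberTheory.EllipticCurves Literature.NumberTheory.EllipticCurves.ModularForms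

namespace Summit.BirchSwinnertonDyer.BirchSwinnertonDyer.Theorems.AlignedTransportAtTwoAddTwistCusp

/-! ## §1 Cusp classes over `ℓ` when `ℓ² ∣ N` -/

section CuspClass

variable {N : ℕ} [NeZero N] (f : CuspForm (Gamma0 N) 2)

/-- **The cusp `p/(kℓ)` lies in the class of `kp/ℓ` when `ℓ² ∣ N` and `gcd(k, pN) = 1`**: `{∞, p/(kℓ)}_f − {∞, kp/ℓ}_f ∈ Λ_f`.
With `N = ℓ²M'` and `ak − pℓM't = 1` (Bézout), the matrix `γ = (a, −p²M't; Nt, k(1 − ℓM'tp))` has determinant `1`, lies in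
`Γ₀(N)`, and `γ(kp/ℓ) = p/(kℓ)` (numerator `p(ak − pℓM't)/ℓ = p/ℓ`, denominator `k`); Manin's relation
`{∞, γr} = {∞, γ∞} + {∞, r}` (`modularSymbol_gamma0_smul_holds`) exhibits the difference as a period. This is Cremona's
criterion (Lemma 2.2.3) for two cusps whose denominators meet `N` in `ℓ` with `ℓ ∣ N/ℓ`: the class depends on the residue
`kp mod ℓ`, NOT only on `ℓ`. [cite: CremonaAlgorithms1997, §2.2 Lemma 2.2.3] [cite: Manin1972, Prop. 1.4 and Thm. 1.6] -/
theorem modularSymbol_div_mul_sub_mem_periodLattice {ℓ M' : ℤ} (hN : (N : ℤ) = ℓ * ℓ * M') (hℓ0 : ℓ ≠ 0)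
    {p k : ℤ} (hk0 : k ≠ 0) (hk : IsCoprime k (p * (ℓ * M'))) :
    modularSymbol f ((p : ℚ) / (k * ℓ)) - modularSymbol f ((k : ℚ) * p / ℓ) ∈ periodLattice f := by
  obtain ⟨a, v, hav⟩ := hk
  -- `a k − p ℓ M' t = 1` with `t = -v`
  set t : ℤ := -v with ht
  have hbez : a * k - p * ℓ * M' * t = 1 := by rw [ht]; linear_combination hav
  let γ : SL(2, ℤ) := ⟨!![a, -(p * p * M' * t); (N : ℤ) * t, k * (1 - ℓ * M' * t * p)], by
    rw [Matrix.det_fin_two_of, hN]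
    linear_combination (1 - p * ℓ * M' * t) * hbez⟩
  have hγ0 : γ ∈ Gamma0 N := by
    rw [Gamma0_mem]
    show ((((N : ℤ) * t : ℤ)) : ZMod N) = 0
    push_cast
    rw [ZMod.natCast_self, zero_mul]
  have hℓQ : (ℓ : ℚ) ≠ 0 := by exact_mod_cast hℓ0
  have hkQ : (k : ℚ) ≠ 0 := by exact_mod_cast hk0
  have e00 : (γ 0 0 : ℤ) = a := rfl
  have e01 : (γ 0 1 : ℤ) = -(p * p * M' * t) := rfl
  have e10 : (γ 1 0 : ℤ) = (N : ℤ) * t := rfl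
  have e11 : (γ 1 1 : ℤ) = k * (1 - ℓ * M' * t * p) := rfl
  set r : ℚ := (k : ℚ) * p / ℓ with hr
  have hden : ((γ 1 0 : ℤ) : ℚ) * r + ((γ 1 1 : ℤ) : ℚ) = k := by
    rw [e10, e11, hr, hN]
    push_cast
    field_simp
    ring
  have hnum : ((γ 0 0 : ℤ) : ℚ) * r + ((γ 0 1 : ℤ) : ℚ) = (p : ℚ) / ℓ := by
    rw [e00, e01, hr]
    have hbezQ : (a : ℚ) * k - p * ℓ * M' * t = 1 := by exact_mod_cast hbez
    push_cast
    field_simp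
    linear_combination (p : ℚ) * hbezQ
  have hne : ((γ 1 0 : ℤ) : ℚ) * r + ((γ 1 1 : ℤ) : ℚ) ≠ 0 := by rw [hden]; exact hkQ
  have key := modularSymbol_gamma0_smul_holds f ⟨γ, hγ0⟩ r hne
  have hquot : (((γ 0 0 : ℤ) : ℚ) * r + ((γ 0 1 : ℤ) : ℚ)) / (((γ 1 0 : ℤ) : ℚ) * r + ((γ 1 1 : ℤ) : ℚ)) =
      (p : ℚ) / (k * ℓ) := by
    rw [hnum, hden, div_div, mul_comm]
  rw [hquot] at key
  rw [key, add_sub_cancel_right]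
  exact cuspSymbol_mem_periodLattice f _

end CuspClass

/-! ## §2 The same for the rational plus symbols: `[x]⁺ = [x']⁺ + j/2` -/

section RatSymbols

variable {N : ℕ} [NeZero N] (f : CuspForm (Gamma0 N) 2)

/-- **`[x]⁺_f = [x']⁺_f + j/2` whenever `{∞, x}_f ≡ {∞, x'}_f (mod Λ_f)`** (real coefficients, `([r]⁺ : ℝ) = [r]`):
`re Λ_f = ℤ·Ω⁺_f/2` and `[r]⁺ = re{∞, r}/Ω⁺_f` (`plusSymbol_eq_re_holds`); junk case `Ω⁺_f = 0`: both symbols vanish.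
[cite: CremonaAlgorithms1997, §2.8] [cite: MazurTateTeitelbaum1986Invent, §I.8] -/
theorem exists_ratPlusSymbol_eq_add_div_two_of_sub_mem (hreal : ∀ n, (cuspCoeff f n).im = 0)
    (hrat : ∀ r : ℚ, (ratPlusSymbol f r : ℝ) = normalizedPlusSymbol f r) {x x' : ℚ}
    (h : modularSymbol f x - modularSymbol f x' ∈ periodLattice f) :
    ∃ j : ℤ, ratPlusSymbol f x = ratPlusSymbol f x' + (j : ℚ) / 2 := by
  by_cases hΩ : plusPeriod f = 0
  · refine ⟨0, ?_⟩
    apply Rat.cast_injective (α := ℝ)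
    push_cast
    rw [hrat, hrat, normalizedPlusSymbol_eq_zero_of_plusPeriod_eq_zero f hΩ,
      normalizedPlusSymbol_eq_zero_of_plusPeriod_eq_zero f hΩ]
    simp
  obtain ⟨hre, hpos⟩ := realPeriods_eq_zmultiples_of_plusPeriod_ne_zero f hΩ
  obtain ⟨k, hk⟩ := exists_re_eq_add_of_sub_mem f hre h
  refine ⟨k, ?_⟩
  apply Rat.cast_injective (α := ℝ)
  push_cast
  rw [hrat, hrat, normalizedPlusSymbol, normalizedPlusSymbol, plusSymbol_eq_re_holds f hreal x,
    plusSymbol_eq_re_holds f hreal x', Complex.ofReal_re, Complex.ofReal_re, hk]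
  field_simp

/-- **`[p/(kℓ)]⁺ = [kp/ℓ]⁺ + j/2` when `ℓ² ∣ N` and `gcd(k, pN) = 1`** (§1 read on real parts).
[cite: CremonaAlgorithms1997, §2.2 Lemma 2.2.3 and §2.8] -/
theorem exists_ratPlusSymbol_div_mul_eq_add_div_two (hreal : ∀ n, (cuspCoeff f n).im = 0)
    (hrat : ∀ r : ℚ, (ratPlusSymbol f r : ℝ) = normalizedPlusSymbol f r)
    {ℓ M' : ℤ} (hN : (N : ℤ) = ℓ * ℓ * M') (hℓ0 : ℓ ≠ 0) {p k : ℤ} (hk0 : k ≠ 0) (hk : IsCoprime k (p * (ℓ * M'))) :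
    ∃ j : ℤ, ratPlusSymbol f ((p : ℚ) / (k * ℓ)) = ratPlusSymbol f ((k : ℚ) * p / ℓ) + (j : ℚ) / 2 :=
  exists_ratPlusSymbol_eq_add_div_two_of_sub_mem f hreal hrat
    (modularSymbol_div_mul_sub_mem_periodLattice f hN hℓ0 hk0 hk)

/-- **`[u/ℓ]⁺` only depends on `u mod ℓ`**: `(u : ZMod ℓ) = (u' : ZMod ℓ) ⟹ [u/ℓ]⁺ = [u'/ℓ]⁺` (translation by the integer
`(u − u')/ℓ`, `ratPlusSymbol_add_intCast_eq`). [cite: MazurTateTeitelbaum1986Invent, §I.4 (4.2)] -/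
theorem ratPlusSymbol_div_eq_of_intCast_eq {ℓ : ℕ} (hℓ0 : ℓ ≠ 0) {u u' : ℤ} (h : (u : ZMod ℓ) = (u' : ZMod ℓ)) :
    ratPlusSymbol f ((u : ℚ) / ℓ) = ratPlusSymbol f ((u' : ℚ) / ℓ) := by
  obtain ⟨t, ht⟩ := (ZMod.intCast_eq_intCast_iff_dvd_sub u' u ℓ).mp h.symm
  have hℓQ : (ℓ : ℚ) ≠ 0 := by exact_mod_cast hℓ0
  have hu : (u : ℚ) / ℓ = (u' : ℚ) / ℓ + (t : ℚ) := by
    have : (u : ℤ) = u' + ℓ * t := by linear_combination ht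
    rw [this]
    push_cast
    field_simp
  rw [hu, ratPlusSymbol_add_intCast_eq]

end RatSymbols

/-! ## §3 The Hecke relation `T_q` at the cusps `u/ℓ` -/

section Hecke

variable {N : ℕ} [NeZero N] (f : CuspForm (Gamma0 N) 2)

omit [NeZero N] in
/-- Summing congruences mod `½ℤ`: if `g j = h j + i_j/2` termwise then `Σ g = Σ h + i/2`. [folklore] -/
theorem exists_sum_eq_sum_add_div_two {ι : Type*} (s : Finset ι) {g h : ι → ℚ}
    (hgh : ∀ j ∈ s, ∃ i : ℤ, g j = h j + (i : ℚ) / 2) :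
    ∃ i : ℤ, ∑ j ∈ s, g j = ∑ j ∈ s, h j + (i : ℚ) / 2 := by
  classical
  induction s using Finset.induction_on with
  | empty => exact ⟨0, by simp⟩
  | insert a s ha ih =>
    obtain ⟨i₁, hi₁⟩ := hgh a (Finset.mem_insert_self a s)
    obtain ⟨i₂, hi₂⟩ := ih fun j hj ↦ hgh j (Finset.mem_insert_of_mem hj)
    refine ⟨i₁ + i₂, ?_⟩
    rw [Finset.sum_insert ha, Finset.sum_insert ha, hi₁, hi₂]
    push_cast
    ring

/-- For primes `q ≠ ℓ` and `u ∈ ℤ` there is exactly one `j ∈ [0, q)` with `q ∣ u + jℓ`, namely `j ≡ −uℓ⁻¹ (mod q)`;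
stated as the equivalence with `j = j₀`. [folklore] -/
theorem dvd_add_mul_iff_eq {q ℓ : ℕ} [Fact q.Prime] (hqℓ : ¬ q ∣ ℓ) (u : ℤ) (j : Fin q) :
    (q : ℤ) ∣ u + (j : ℕ) * ℓ ↔
      j = ⟨((-(u : ZMod q)) * ((ℓ : ZMod q))⁻¹).val, ZMod.val_lt _⟩ := by
  have hq : q.Prime := Fact.out
  have hℓ0 : ((ℓ : ZMod q)) ≠ 0 := by
    rw [Ne, ZMod.natCast_eq_zero_iff]
    exact hqℓ
  have hcast : ((u + (j : ℕ) * ℓ : ℤ) : ZMod q) = (u : ZMod q) + ((j : ℕ) : ZMod q) * (ℓ : ZMod q) := by push_cast; ring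
  rw [← ZMod.intCast_zmod_eq_zero_iff_dvd, hcast, Fin.ext_iff]
  change _ ↔ (j : ℕ) = ((-(u : ZMod q)) * ((ℓ : ZMod q))⁻¹).val
  constructor
  · intro h
    have hj : ((j : ℕ) : ZMod q) = (-(u : ZMod q)) * ((ℓ : ZMod q))⁻¹ := by
      rw [eq_mul_inv_iff_mul_eq₀ hℓ0]
      linear_combination h
    rw [← hj, ZMod.val_natCast, Nat.mod_eq_of_lt j.isLt]
  · intro h
    have hj : ((j : ℕ) : ZMod q) = (-(u : ZMod q)) * ((ℓ : ZMod q))⁻¹ := by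
      rw [h, ZMod.natCast_zmod_val]
    rw [hj, inv_mul_cancel_right₀ hℓ0, add_neg_cancel]

/-- **`T_q` at the cusp `u/ℓ` when `ℓ² ∣ N`** (`q ∤ N` prime, `f` a rational newform with real coefficients): with `qu' ≡ u (mod ℓ)`,
`a_q [u/ℓ]⁺ = q·[qu/ℓ]⁺ + [u'/ℓ]⁺ + j/2` for some `j ∈ ℤ`. In the Hecke relation
`a_q[u/ℓ]⁺ = Σ_{j mod q} [(u + jℓ)/(qℓ)]⁺ + [qu/ℓ]⁺` (`intCast_mul_ratPlusSymbol`) the `q − 1` cusps with `q ∤ u + jℓ` lie in the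
class `[q(u + jℓ)/ℓ] = [qu/ℓ]` (§1–§2), and the one with `q ∣ u + jℓ = qv` is `v/ℓ` with `v ≡ u' (mod ℓ)`.
[cite: MazurTateTeitelbaum1986Invent, §I.4 (4.2)] [cite: CremonaAlgorithms1997, §2.2 Lemma 2.2.3 and §2.8 (2.8.8)] -/
theorem exists_intCast_mul_ratPlusSymbol_div_eq (hf : IsNewform0 f) (hreal : ∀ n, (cuspCoeff f n).im = 0)
    (hrat : ∀ r : ℚ, (ratPlusSymbol f r : ℝ) = normalizedPlusSymbol f r)
    {ℓ : ℕ} [Fact ℓ.Prime] (hℓN : ℓ ^ 2 ∣ N) {q : ℕ} [Fact q.Prime] (hqN : ¬ q ∣ N)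
    {aq : ℤ} (haq : cuspCoeff f q = aq) (u u' : ℤ) (hu' : ((q : ℤ) * u' : ZMod ℓ) = (u : ZMod ℓ)) :
    ∃ j : ℤ, (aq : ℚ) * ratPlusSymbol f ((u : ℚ) / ℓ) =
      (q : ℚ) * ratPlusSymbol f (((q : ℤ) * u : ℚ) / ℓ) + ratPlusSymbol f ((u' : ℚ) / ℓ) + (j : ℚ) / 2 := by
  have hq : q.Prime := Fact.out
  have hℓ : ℓ.Prime := Fact.out
  obtain ⟨M', hM'⟩ := hℓN
  have hN : (N : ℤ) = (ℓ : ℤ) * ℓ * M' := by rw [hM']; push_cast; ring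
  have hℓ0 : (ℓ : ℤ) ≠ 0 := by exact_mod_cast hℓ.ne_zero
  have hℓQ : (ℓ : ℚ) ≠ 0 := by exact_mod_cast hℓ.ne_zero
  have hq0 : (q : ℤ) ≠ 0 := by exact_mod_cast hq.ne_zero
  have hqQ : (q : ℚ) ≠ 0 := by exact_mod_cast hq.ne_zero
  have hqprime : Prime (q : ℤ) := Nat.prime_iff_prime_int.mp hq
  -- `q ∤ ℓ`, `q ∤ M'`
  have hqℓ : ¬ q ∣ ℓ := fun h ↦ hqN (h.trans (Dvd.intro (ℓ * M') (by rw [hM']; ring)))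
  have hqM' : ¬ (q : ℤ) ∣ (M' : ℤ) := fun h ↦ hqN (by
    have h' : q ∣ M' := by exact_mod_cast h
    exact h'.trans (Dvd.intro_left (ℓ ^ 2) (by rw [hM'])))
  have hqℓM' : ¬ (q : ℤ) ∣ (ℓ : ℤ) * M' := by
    intro h
    rcases hqprime.dvd_or_dvd h with h1 | h1
    · exact hqℓ (by exact_mod_cast h1)
    · exact hqM' h1
  -- the Hecke relation at `r = u/ℓ`
  have hH := intCast_mul_ratPlusSymbol (p := q) hf hq hqN haq hrat ((u : ℚ) / ℓ)
  have hlast : ratPlusSymbol f ((q : ℚ) * ((u : ℚ) / ℓ)) = ratPlusSymbol f (((q : ℤ) * u : ℚ) / ℓ) := by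
    congr 1; push_cast; ring
  -- the main term of each of the `q` cusps `(u + jℓ)/(qℓ)`
  set j₀ : Fin q := ⟨((-(u : ZMod q)) * ((ℓ : ZMod q))⁻¹).val, ZMod.val_lt _⟩ with hj₀
  set A : ℚ := ratPlusSymbol f ((u' : ℚ) / ℓ) with hA
  set B : ℚ := ratPlusSymbol f (((q : ℤ) * u : ℚ) / ℓ) with hB
  have hterm : ∀ j ∈ (Finset.univ : Finset (Fin q)), ∃ i : ℤ,
      ratPlusSymbol f (((u : ℚ) / ℓ + ((j : ℕ) : ℚ)) / q) = (if j = j₀ then A else B) + (i : ℚ) / 2 := by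
    intro j _
    have hfrac : ((u : ℚ) / ℓ + ((j : ℕ) : ℚ)) / q = ((u + (j : ℕ) * ℓ : ℤ) : ℚ) / ((q : ℤ) * ℓ) := by
      push_cast; field_simp
    rw [hfrac]
    by_cases hdvd : (q : ℤ) ∣ u + (j : ℕ) * ℓ
    · -- the cusp `((u + jℓ)/q)/ℓ`, in the class of `u'/ℓ`
      have hj : j = j₀ := (dvd_add_mul_iff_eq hqℓ u j).mp hdvd
      rw [if_pos hj]
      obtain ⟨v, hv⟩ := hdvd
      refine ⟨0, ?_⟩
      have hfrac' : ((u + (j : ℕ) * ℓ : ℤ) : ℚ) / ((q : ℤ) * ℓ) = (v : ℚ) / ℓ := by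
        rw [hv]; push_cast; field_simp
      have hvu' : (v : ZMod ℓ) = (u' : ZMod ℓ) := by
        have hqℓ0 : ((q : ℤ) : ZMod ℓ) ≠ 0 := by
          rw [Int.cast_natCast, Ne, ZMod.natCast_eq_zero_iff]
          intro h
          exact hqℓ (by
            have := (Nat.prime_dvd_prime_iff_eq hℓ hq).mp h
            rw [this])
        apply mul_left_cancel₀ hqℓ0
        have h1 : (((q : ℤ) * v : ℤ) : ZMod ℓ) = ((u + (j : ℕ) * ℓ : ℤ) : ZMod ℓ) := by rw [hv]
        push_cast at h1 hu' ⊢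
        rw [ZMod.natCast_self, mul_zero, add_zero] at h1
        rw [h1, ← hu']
      rw [hfrac', ratPlusSymbol_div_eq_of_intCast_eq f hℓ.ne_zero hvu', Int.cast_zero, zero_div, add_zero]
    · -- a cusp of denominator `qℓ`, in the class of `q(u + jℓ)/ℓ = qu/ℓ`
      have hj : j ≠ j₀ := fun h ↦ hdvd ((dvd_add_mul_iff_eq hqℓ u j).mpr h)
      rw [if_neg hj]
      have hcop : IsCoprime (q : ℤ) ((u + (j : ℕ) * ℓ) * ((ℓ : ℤ) * M')) := by
        rw [Prime.coprime_iff_not_dvd hqprime]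
        intro h
        rcases hqprime.dvd_or_dvd h with h1 | h1
        · exact hdvd h1
        · exact hqℓM' h1
      obtain ⟨i, hi⟩ := exists_ratPlusSymbol_div_mul_eq_add_div_two f hreal hrat hN hℓ0 hq0 hcop
      refine ⟨i, ?_⟩
      have hcl : (((q : ℤ) * (u + (j : ℕ) * ℓ) : ℤ) : ZMod ℓ) = (((q : ℤ) * u : ℤ) : ZMod ℓ) := by
        push_cast
        rw [ZMod.natCast_self, mul_zero, add_zero]
      have h := ratPlusSymbol_div_eq_of_intCast_eq f hℓ.ne_zero hcl
      rw [hB]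
      push_cast at hi h ⊢
      rw [hi, h]
  obtain ⟨i, hi⟩ := exists_sum_eq_sum_add_div_two (Finset.univ : Finset (Fin q)) hterm
  -- `Σ_j (if j = j₀ then A else B) = A + (q − 1) B`
  have hsum : ∑ j : Fin q, (if j = j₀ then A else B) = A + ((q : ℚ) - 1) * B := by
    have h1 : ∀ j : Fin q, (if j = j₀ then A else B) = B + (if j = j₀ then A - B else 0) := by
      intro j; split_ifs <;> ring
    simp_rw [h1]
    rw [Finset.sum_add_distrib, Finset.sum_const, Finset.card_univ, Fintype.card_fin, Finset.sum_ite_eq',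
      if_pos (Finset.mem_univ _), nsmul_eq_mul]
    ring
  refine ⟨i, ?_⟩
  rw [hH, hlast, hi, hsum]
  ring

end Hecke

end Summit.BirchSwinnertonDyer.BirchSwinnertonDyer.Theorems.AlignedTransportAtTwoAddTwistCusp

end
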